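import Literature.Geometry.Kaehler.ComplexTorusHodgeGroupProductNoCommonFactor
import HarnessLib

/-!
# Non-split products with a Lie-simple factor: if `Lie Hg(X₂)(ℂ)` is simple and `Hg(X₁ × X₂) ≠ Hg(X₁) × Hg(X₂)`, then
# `Lie Hg(X₁ × X₂)(ℂ) ≅ Lie Hg(X₁)(ℂ)`, `Lie Hg(X₂)(ℂ)` is a QUOTIENT of `Lie Hg(X₁)(ℂ)`, and — for polarised `X₁` — a DIRECT
# FACTOR (ideal) of `Lie Hg(X₁)(ℂ)` (Moonen–Zarhin: `𝔥𝔤(X₁) ≅ 𝔤₁ ⊕ 𝔤₃`, `𝔥𝔤(X₂) ≅ 𝔤₃`)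

Layer `Literature/Geometry/Kaehler`, namespace `Literature.Geometry.Kaehler.ComplexTorus`; lane `lit-hodgefound` (Track 2
foundations library), Layer A3/A4; prover seat `lit-hodgefound-p17` (generation 40, self-proposed row g40-#11, sequel of g40-#7/#8).
THEOREMS ONLY (no definition, no instance, no notation, no named fact; D-0026 net debt 0).  Dictionary: `G = Hg(X₁ × X₂)(ℂ)`,
`Gᵢ = Hg(Xᵢ)(ℂ)` in `GL` through `toGL`, `Lie G = lieSubalgebraGL G`, `𝔥𝔤_ℂ(X) = hodgeGroupComplexLie` (`= Lie Hg(X)(ℂ)`).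

MOONEN–ZARHIN (held `paper:arxiv-math_9901113`), §3 (3.1) p0006 L24–L60 (`𝔥𝔤(X₁) ≅ 𝔤₁ ⊕ 𝔤₃`, `𝔥𝔤(X₂) ≅ 𝔤₂ ⊕ 𝔤₃`,
`𝔥𝔤(X₁ × X₂) ≅ 𝔤₁ ⊕ 𝔤₂ ⊕ Γ_φ`; «We may have that `Hg(X₁ × X₂) ≠ Hg(X₁) × Hg(X₂)`. (I.e., `𝔤₃ ≠ 0` in the above.)») and the
proof of Lemma (3.7) p0007 L1–L7 («the assumption that `𝔥𝔤(X₂)` is `ℚ`-simple implies that `𝔥𝔤(X) = 𝔤₁ ⊕ 𝔤₃ ≅ 𝔥𝔤(X₁)` and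
`𝔥𝔤(X₂) ≅ 𝔤₃`»): with `𝔥𝔤(X₂)` SIMPLE and the product NOT split, `𝔤₂ = 0` and `𝔤₃ = 𝔥𝔤(X₂)`.  Here over `ℂ`, for arbitrary complex
tori (the direct-factor statement for polarised `X₁`, where `𝔥𝔤_ℂ(X₁)` is reductive, Deligne I 3.6).

## What is proved

* §1 (arbitrary tori; `Lie G₂` simple, `Hg(X₁ × X₂) ≠ Hg(X₁) × Hg(X₂)`): **`nonempty_lieEquiv_of_isSimple_right_of_ne`**
  (`Lie G ≃ₗ⁅ℂ⁆ Lie G₁` through `r₁` — "`𝔥𝔤(X) ≅ 𝔥𝔤(X₁)`"), **`exists_surjective_lieHom_of_isSimple_right_of_ne`** (a surjective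
  `Lie G₁ → Lie G₂`: `𝔥𝔤(X₂)` is a quotient of `𝔥𝔤(X₁)`), **`exists_lieIdeal_lieEquiv_of_isSimple_right_of_ne`** (`Lie G₁` REDUCTIVE ⟹ an
  ideal `C ⊆ Lie G₁` with `C ≃ₗ⁅ℂ⁆ Lie G₂` — "`𝔥𝔤(X₂) ≅ 𝔤₃ ⊆ 𝔥𝔤(X₁)`"), and the mirror `exists_lieIdeal_lieEquiv_of_isSimple_left_of_ne`.
* §2 (analytic vocabulary, polarised `X₁`): **`IsRiemannForm.exists_lieIdeal_lieEquiv_hodgeGroupComplexLie_of_isSimple_of_ne`**, and the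
  contrapositives **`IsRiemannForm.hodgeGroupC_prod_eq_blockDiagProd_of_isSimple_of_forall_lieIdeal_isEmpty_lieEquiv`** (no ideal of
  `𝔥𝔤_ℂ(X₁)` is isomorphic to the simple `𝔥𝔤_ℂ(X₂)` ⟹ split) and **`…_of_forall_lieIdeal_finrank_ne`** (no ideal of `𝔥𝔤_ℂ(X₁)` has
  dimension `dim 𝔥𝔤_ℂ(X₂)` ⟹ split — e.g. `dim 𝔥𝔤_ℂ(X₂) > dim 𝔥𝔤_ℂ(X₁)`, recovering g38-#5's dimension route), with the (D)-transfer.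

## References

* [MoonenZarhin1999LowDim] B. Moonen, Yu. G. Zarhin, Math. Ann. 315 (1999), §3 (3.1), Lemma (3.7) (proof).
* [Gordon1997] B. B. Gordon, *A survey of the Hodge conjecture for abelian varieties* (alg-geom/9709030), §2.16 Proposition.
* [Deligne1982HodgeCycles] P. Deligne, *Hodge cycles on abelian varieties*, LNM 900 (1982), I Prop. 3.6.
* [Hazama1983] F. Hazama, Tôhoku Math. J. 35 (1983), Lemma (3.1).
-/

noncomputable section

open Matrix Module

namespace Literature.Geometry.Kaehler

namespace ComplexTorus

open Literature.NumberTheory.Automorphic (lieAlgebraGL lieSubalgebraGL)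
open Literature.Algebra.Lie

variable {ι₁ ι₂ : Type*} [Fintype ι₁] [Fintype ι₂] [DecidableEq ι₁] [DecidableEq ι₂]
  {E₁ E₂ : Type*} [NormedAddCommGroup E₁] [NormedSpace ℂ E₁] [NormedAddCommGroup E₂] [NormedSpace ℂ E₂]
  (Φ₁ : (ι₁ → ℝ) ≃L[ℝ] E₁) (Φ₂ : (ι₂ → ℝ) ≃L[ℝ] E₂)

/-! ### §1 `Lie G₂` simple and the product not split -/

/-- Core step: for the block projections `r₁`, `r₂` of a NON-SPLIT product with `Lie G₂` simple, the Goursat ideal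
`𝔫₂ = r₂(ker r₁) ⊆ Lie G₂` vanishes (it is `0` or all of `Lie G₂`, and the latter means the product splits).
[cite: MoonenZarhin1999LowDim, §3 (3.1)] [cite: Gordon1997, §2.16 Proposition] -/
private theorem map_ker_eq_bot_of_isSimple_right_of_ne
    [LieAlgebra.IsSimple ℂ (lieSubalgebraGL ((hodgeGroupC Φ₂).map Matrix.SpecialLinearGroup.toGL))]
    {f : lieSubalgebraGL ((hodgeGroupC (prodPeriod Φ₁ Φ₂)).map Matrix.SpecialLinearGroup.toGL) →ₗ⁅ℂ⁆
      lieSubalgebraGL ((hodgeGroupC Φ₁).map Matrix.SpecialLinearGroup.toGL)}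
    {g : lieSubalgebraGL ((hodgeGroupC (prodPeriod Φ₁ Φ₂)).map Matrix.SpecialLinearGroup.toGL) →ₗ⁅ℂ⁆
      lieSubalgebraGL ((hodgeGroupC Φ₂).map Matrix.SpecialLinearGroup.toGL)}
    (hfs : Function.Surjective f) (hgs : Function.Surjective g) (hker : f.ker ⊓ g.ker = ⊥)
    (hne : hodgeGroupC (prodPeriod Φ₁ Φ₂) ≠ blockDiagProd (hodgeGroupC Φ₁) (hodgeGroupC Φ₂)) : LieIdeal.map g f.ker = ⊥ := by
  rcases LieAlgebra.IsSimple.eq_bot_or_eq_top (LieIdeal.map g f.ker) with h | h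
  · exact h
  · exfalso
    apply hne
    haveI : Module.Finite ℂ (lieSubalgebraGL ((hodgeGroupC (prodPeriod Φ₁ Φ₂)).map Matrix.SpecialLinearGroup.toGL)) :=
      (isZConnected_map_toGL_hodgeGroupC (prodPeriod Φ₁ Φ₂)).finrank_lieAlgebraGL_eq.1
    haveI : Module.Finite ℂ (lieSubalgebraGL ((hodgeGroupC Φ₁).map Matrix.SpecialLinearGroup.toGL)) :=
      (isZConnected_map_toGL_hodgeGroupC Φ₁).finrank_lieAlgebraGL_eq.1
    have h1 : LieIdeal.map f g.ker = ⊤ := (GoursatLemma.map_ker_eq_top_iff f g hfs hgs).2 h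
    exact (hodgeGroupC_prod_eq_blockDiagProd_iff_finrank_lieAlgebraGL_eq_add Φ₁ Φ₂).2
      ((GoursatLemma.finrank_eq_add_iff_map_ker_eq_top f g hfs hgs hker).2 h1)

/-- **`Lie Hg(X₂)(ℂ)` simple and `Hg(X₁ × X₂) ≠ Hg(X₁) × Hg(X₂)` ⟹ `Lie Hg(X₁ × X₂)(ℂ) ≅ Lie Hg(X₁)(ℂ)`** (the block projection `r₁`
is bijective: `𝔫₂ = 0` means `ker r₁ ⊆ ker r₂`, and `ker r₁ ⊓ ker r₂ = 0`) — Moonen–Zarhin's "`𝔥𝔤(X) = 𝔤₁ ⊕ 𝔤₃ ≅ 𝔥𝔤(X₁)`".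
[cite: MoonenZarhin1999LowDim, §3 (3.1) and Lemma (3.7) (proof)] [cite: Gordon1997, §2.16 Proposition] -/
theorem nonempty_lieEquiv_of_isSimple_right_of_ne
    [LieAlgebra.IsSimple ℂ (lieSubalgebraGL ((hodgeGroupC Φ₂).map Matrix.SpecialLinearGroup.toGL))]
    (hne : hodgeGroupC (prodPeriod Φ₁ Φ₂) ≠ blockDiagProd (hodgeGroupC Φ₁) (hodgeGroupC Φ₂)) :
    Nonempty (lieSubalgebraGL ((hodgeGroupC (prodPeriod Φ₁ Φ₂)).map Matrix.SpecialLinearGroup.toGL) ≃ₗ⁅ℂ⁆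
      lieSubalgebraGL ((hodgeGroupC Φ₁).map Matrix.SpecialLinearGroup.toGL)) := by
  obtain ⟨f, g, -, -, hfs, hgs, hker⟩ := exists_lieHom_toBlocks Φ₁ Φ₂
  have h := map_ker_eq_bot_of_isSimple_right_of_ne Φ₁ Φ₂ hfs hgs hker hne
  have hinj : Function.Injective f := GoursatLemma.injective_of_map_ker_eq_bot g f (by rw [inf_comm, hker]) h
  exact ⟨LieEquiv.ofBijective f ⟨hinj, hfs⟩⟩

/-- **`Lie Hg(X₂)(ℂ)` simple and the product not split ⟹ `Lie Hg(X₂)(ℂ)` is a QUOTIENT of `Lie Hg(X₁)(ℂ)`**: a surjective Lie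
homomorphism `Lie Hg(X₁)(ℂ) → Lie Hg(X₂)(ℂ)` (`r₂ ∘ r₁⁻¹`). [cite: MoonenZarhin1999LowDim, §3 (3.1) and Lemma (3.7) (proof)]
[cite: Gordon1997, §2.16 Proposition] -/
theorem exists_surjective_lieHom_of_isSimple_right_of_ne
    [LieAlgebra.IsSimple ℂ (lieSubalgebraGL ((hodgeGroupC Φ₂).map Matrix.SpecialLinearGroup.toGL))]
    (hne : hodgeGroupC (prodPeriod Φ₁ Φ₂) ≠ blockDiagProd (hodgeGroupC Φ₁) (hodgeGroupC Φ₂)) :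
    ∃ q : lieSubalgebraGL ((hodgeGroupC Φ₁).map Matrix.SpecialLinearGroup.toGL) →ₗ⁅ℂ⁆
      lieSubalgebraGL ((hodgeGroupC Φ₂).map Matrix.SpecialLinearGroup.toGL), Function.Surjective q := by
  obtain ⟨f, g, -, -, hfs, hgs, hker⟩ := exists_lieHom_toBlocks Φ₁ Φ₂
  have h := map_ker_eq_bot_of_isSimple_right_of_ne Φ₁ Φ₂ hfs hgs hker hne
  have hinj : Function.Injective f := GoursatLemma.injective_of_map_ker_eq_bot g f (by rw [inf_comm, hker]) h
  let e := LieEquiv.ofBijective f ⟨hinj, hfs⟩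
  refine ⟨g.comp (e.symm : _ →ₗ⁅ℂ⁆ _), fun b ↦ ?_⟩
  obtain ⟨x, rfl⟩ := hgs b
  refine ⟨e x, ?_⟩
  change g (e.symm (e x)) = g x
  rw [e.symm_apply_apply]

/-- **`Lie Hg(X₁)(ℂ)` REDUCTIVE, `Lie Hg(X₂)(ℂ)` SIMPLE, `Hg(X₁ × X₂) ≠ Hg(X₁) × Hg(X₂)` ⟹ `Lie Hg(X₂)(ℂ)` is (isomorphic to) an IDEAL
of `Lie Hg(X₁)(ℂ)`** — Moonen–Zarhin's `𝔥𝔤(X₂) ≅ 𝔤₃`, a direct factor of `𝔥𝔤(X₁) = 𝔤₁ ⊕ 𝔤₃` (Goursat with the direct factors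
`C₁ = 𝔤₃` of `𝔫₁` and `C₂ = ⊤` of `𝔫₂ = 0`). [cite: MoonenZarhin1999LowDim, §3 (3.1) and Lemma (3.7) (proof)] [cite: Gordon1997, §2.16 Proposition] -/
theorem exists_lieIdeal_lieEquiv_of_isSimple_right_of_ne
    [LieAlgebra.HasCentralRadical ℂ (lieSubalgebraGL ((hodgeGroupC Φ₁).map Matrix.SpecialLinearGroup.toGL))]
    [LieAlgebra.IsSimple ℂ (lieSubalgebraGL ((hodgeGroupC Φ₂).map Matrix.SpecialLinearGroup.toGL))]
    (hne : hodgeGroupC (prodPeriod Φ₁ Φ₂) ≠ blockDiagProd (hodgeGroupC Φ₁) (hodgeGroupC Φ₂)) :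
    ∃ C : LieIdeal ℂ (lieSubalgebraGL ((hodgeGroupC Φ₁).map Matrix.SpecialLinearGroup.toGL)),
      Nonempty (C ≃ₗ⁅ℂ⁆ lieSubalgebraGL ((hodgeGroupC Φ₂).map Matrix.SpecialLinearGroup.toGL)) := by
  obtain ⟨f, g, -, -, hfs, hgs, hker⟩ := exists_lieHom_toBlocks Φ₁ Φ₂
  have h := map_ker_eq_bot_of_isSimple_right_of_ne Φ₁ Φ₂ hfs hgs hker hne
  haveI : Module.Finite ℂ (lieSubalgebraGL ((hodgeGroupC Φ₁).map Matrix.SpecialLinearGroup.toGL)) :=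
    (isZConnected_map_toGL_hodgeGroupC Φ₁).finrank_lieAlgebraGL_eq.1
  obtain ⟨C₁, hC₁⟩ := exists_ideal_isCompl (k := ℂ) (LieIdeal.map f g.ker)
  have hC₂ : IsCompl (LieIdeal.map g f.ker) (⊤ : LieIdeal ℂ (lieSubalgebraGL ((hodgeGroupC Φ₂).map Matrix.SpecialLinearGroup.toGL))) := by
    rw [h]
    exact isCompl_bot_top
  obtain ⟨e⟩ := GoursatSemisimple.nonempty_lieEquiv_of_isCompl f g hfs hgs hC₁ hC₂
  exact ⟨C₁, ⟨e.trans LieIdeal.topEquiv⟩⟩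

/-- Core step, mirrored: `Lie G₁` simple and the product not split ⟹ `𝔫₁ = r₁(ker r₂) = 0`. [cite: MoonenZarhin1999LowDim, §3 (3.1)] -/
private theorem map_ker_eq_bot_of_isSimple_left_of_ne
    [LieAlgebra.IsSimple ℂ (lieSubalgebraGL ((hodgeGroupC Φ₁).map Matrix.SpecialLinearGroup.toGL))]
    {f : lieSubalgebraGL ((hodgeGroupC (prodPeriod Φ₁ Φ₂)).map Matrix.SpecialLinearGroup.toGL) →ₗ⁅ℂ⁆
      lieSubalgebraGL ((hodgeGroupC Φ₁).map Matrix.SpecialLinearGroup.toGL)}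
    {g : lieSubalgebraGL ((hodgeGroupC (prodPeriod Φ₁ Φ₂)).map Matrix.SpecialLinearGroup.toGL) →ₗ⁅ℂ⁆
      lieSubalgebraGL ((hodgeGroupC Φ₂).map Matrix.SpecialLinearGroup.toGL)}
    (hfs : Function.Surjective f) (hgs : Function.Surjective g) (hker : f.ker ⊓ g.ker = ⊥)
    (hne : hodgeGroupC (prodPeriod Φ₁ Φ₂) ≠ blockDiagProd (hodgeGroupC Φ₁) (hodgeGroupC Φ₂)) : LieIdeal.map f g.ker = ⊥ := by
  rcases LieAlgebra.IsSimple.eq_bot_or_eq_top (LieIdeal.map f g.ker) with h | h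
  · exact h
  · exfalso
    apply hne
    haveI : Module.Finite ℂ (lieSubalgebraGL ((hodgeGroupC (prodPeriod Φ₁ Φ₂)).map Matrix.SpecialLinearGroup.toGL)) :=
      (isZConnected_map_toGL_hodgeGroupC (prodPeriod Φ₁ Φ₂)).finrank_lieAlgebraGL_eq.1
    haveI : Module.Finite ℂ (lieSubalgebraGL ((hodgeGroupC Φ₁).map Matrix.SpecialLinearGroup.toGL)) :=
      (isZConnected_map_toGL_hodgeGroupC Φ₁).finrank_lieAlgebraGL_eq.1
    exact (hodgeGroupC_prod_eq_blockDiagProd_iff_finrank_lieAlgebraGL_eq_add Φ₁ Φ₂).2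
      ((GoursatLemma.finrank_eq_add_iff_map_ker_eq_top f g hfs hgs hker).2 h)

/-- Mirror: **`Lie Hg(X₁)(ℂ)` SIMPLE, `Lie Hg(X₂)(ℂ)` REDUCTIVE, product not split ⟹ `Lie Hg(X₁)(ℂ)` is isomorphic to an ideal of
`Lie Hg(X₂)(ℂ)`.** [cite: MoonenZarhin1999LowDim, §3 (3.1) and Lemma (3.7) (proof)] [cite: Gordon1997, §2.16 Proposition] -/
theorem exists_lieIdeal_lieEquiv_of_isSimple_left_of_ne
    [LieAlgebra.IsSimple ℂ (lieSubalgebraGL ((hodgeGroupC Φ₁).map Matrix.SpecialLinearGroup.toGL))]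
    [LieAlgebra.HasCentralRadical ℂ (lieSubalgebraGL ((hodgeGroupC Φ₂).map Matrix.SpecialLinearGroup.toGL))]
    (hne : hodgeGroupC (prodPeriod Φ₁ Φ₂) ≠ blockDiagProd (hodgeGroupC Φ₁) (hodgeGroupC Φ₂)) :
    ∃ C : LieIdeal ℂ (lieSubalgebraGL ((hodgeGroupC Φ₂).map Matrix.SpecialLinearGroup.toGL)),
      Nonempty (lieSubalgebraGL ((hodgeGroupC Φ₁).map Matrix.SpecialLinearGroup.toGL) ≃ₗ⁅ℂ⁆ C) := by
  obtain ⟨f, g, -, -, hfs, hgs, hker⟩ := exists_lieHom_toBlocks Φ₁ Φ₂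
  have h := map_ker_eq_bot_of_isSimple_left_of_ne Φ₁ Φ₂ hfs hgs hker hne
  haveI : Module.Finite ℂ (lieSubalgebraGL ((hodgeGroupC Φ₂).map Matrix.SpecialLinearGroup.toGL)) :=
    (isZConnected_map_toGL_hodgeGroupC Φ₂).finrank_lieAlgebraGL_eq.1
  obtain ⟨C₂, hC₂⟩ := exists_ideal_isCompl (k := ℂ) (LieIdeal.map g f.ker)
  have hC₁ : IsCompl (LieIdeal.map f g.ker) (⊤ : LieIdeal ℂ (lieSubalgebraGL ((hodgeGroupC Φ₁).map Matrix.SpecialLinearGroup.toGL))) := by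
    rw [h]
    exact isCompl_bot_top
  obtain ⟨e⟩ := GoursatSemisimple.nonempty_lieEquiv_of_isCompl f g hfs hgs hC₁ hC₂
  exact ⟨C₂, ⟨LieIdeal.topEquiv.symm.trans e⟩⟩

/-! ### §2 Polarised `X₁`, analytic vocabulary, and the contrapositives -/

/-- **MOONEN–ZARHIN'S `𝔥𝔤(X₂) ≅ 𝔤₃ ⊆ 𝔥𝔤(X₁)`: for a POLARISED `X₁` and a torus `X₂` with SIMPLE `𝔥𝔤_ℂ(X₂)`, if
`Hg(X₁ × X₂) ≠ Hg(X₁) × Hg(X₂)` then `𝔥𝔤_ℂ(X₂)` is isomorphic to an ideal of `𝔥𝔤_ℂ(X₁)`** (reductivity of `𝔥𝔤_ℂ(X₁)`, Deligne I 3.6).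
[cite: MoonenZarhin1999LowDim, §3 (3.1) and Lemma (3.7) (proof)] [cite: Deligne1982HodgeCycles, I Prop. 3.6] -/
theorem IsRiemannForm.exists_lieIdeal_lieEquiv_hodgeGroupComplexLie_of_isSimple_of_ne {η₁ : E₁ [⋀^Fin 2]→L[ℝ] ℝ}
    (hη₁ : IsRiemannForm Φ₁ η₁) [h₂ : LieAlgebra.IsSimple ℂ (hodgeGroupComplexLie Φ₂)]
    (hne : hodgeGroupC (prodPeriod Φ₁ Φ₂) ≠ blockDiagProd (hodgeGroupC Φ₁) (hodgeGroupC Φ₂)) :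
    ∃ C : LieIdeal ℂ (hodgeGroupComplexLie Φ₁), Nonempty (C ≃ₗ⁅ℂ⁆ hodgeGroupComplexLie Φ₂) := by
  have h₁ := hη₁.hasCentralRadical_hodgeGroupComplexLie
  rw [hodgeGroupComplexLie_eq_lieSubalgebraGL Φ₁] at h₁ ⊢
  rw [hodgeGroupComplexLie_eq_lieSubalgebraGL Φ₂] at h₂ ⊢
  haveI := h₁
  exact exists_lieIdeal_lieEquiv_of_isSimple_right_of_ne Φ₁ Φ₂ hne

/-- **Contrapositive: polarised `X₁`, simple `𝔥𝔤_ℂ(X₂)` NOT isomorphic to any ideal of `𝔥𝔤_ℂ(X₁)` ⟹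
`Hg(X₁ × X₂)(ℂ) = Hg(X₁)(ℂ) × Hg(X₂)(ℂ)`.** [cite: MoonenZarhin1999LowDim, §3 (3.1)] [cite: Gordon1997, §2.16 Proposition] -/
theorem IsRiemannForm.hodgeGroupC_prod_eq_blockDiagProd_of_isSimple_of_forall_lieIdeal_isEmpty_lieEquiv
    {η₁ : E₁ [⋀^Fin 2]→L[ℝ] ℝ} (hη₁ : IsRiemannForm Φ₁ η₁) [LieAlgebra.IsSimple ℂ (hodgeGroupComplexLie Φ₂)]
    (h : ∀ C : LieIdeal ℂ (hodgeGroupComplexLie Φ₁), IsEmpty (C ≃ₗ⁅ℂ⁆ hodgeGroupComplexLie Φ₂)) :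
    hodgeGroupC (prodPeriod Φ₁ Φ₂) = blockDiagProd (hodgeGroupC Φ₁) (hodgeGroupC Φ₂) := by
  by_contra hne
  obtain ⟨C, ⟨e⟩⟩ := hη₁.exists_lieIdeal_lieEquiv_hodgeGroupComplexLie_of_isSimple_of_ne Φ₁ Φ₂ hne
  exact (h C).false e

/-- **Dimension form: polarised `X₁`, simple `𝔥𝔤_ℂ(X₂)`, and NO IDEAL of `𝔥𝔤_ℂ(X₁)` of dimension `dim 𝔥𝔤_ℂ(X₂)` ⟹
`Hg(X₁ × X₂)(ℂ) = Hg(X₁)(ℂ) × Hg(X₂)(ℂ)`** (e.g. `dim 𝔥𝔤_ℂ(X₂) > dim 𝔥𝔤_ℂ(X₁)`: g38-#5's dimension route).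
[cite: MoonenZarhin1999LowDim, §3 (3.1)] [cite: Gordon1997, §2.16 Proposition] -/
theorem IsRiemannForm.hodgeGroupC_prod_eq_blockDiagProd_of_isSimple_of_forall_lieIdeal_finrank_ne
    {η₁ : E₁ [⋀^Fin 2]→L[ℝ] ℝ} (hη₁ : IsRiemannForm Φ₁ η₁) [LieAlgebra.IsSimple ℂ (hodgeGroupComplexLie Φ₂)]
    (h : ∀ C : LieIdeal ℂ (hodgeGroupComplexLie Φ₁), finrank ℂ C ≠ finrank ℂ (hodgeGroupComplexLie Φ₂)) :
    hodgeGroupC (prodPeriod Φ₁ Φ₂) = blockDiagProd (hodgeGroupC Φ₁) (hodgeGroupC Φ₂) :=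
  hη₁.hodgeGroupC_prod_eq_blockDiagProd_of_isSimple_of_forall_lieIdeal_isEmpty_lieEquiv Φ₁ Φ₂ fun C ↦
    ⟨fun e ↦ h C e.toLinearEquiv.finrank_eq⟩

variable {Φ₁ Φ₂} in
/-- (D)-transfer under the dimension form: polarised stably nondegenerate `X₁`, stably nondegenerate `X₂` with simple `𝔥𝔤_ℂ(X₂)` whose
dimension is not the dimension of an ideal of `𝔥𝔤_ℂ(X₁)` ⟹ `X₁ × X₂` stably nondegenerate. [cite: MoonenZarhin1999LowDim, §3 (3.1) and Thm. (3.2)]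
[cite: Gordon1997, Thm. 7.6.2] -/
theorem IsRiemannForm.forall_divisorClasses_powPeriod_prod_eq_hodgeClasses_of_isSimple_of_forall_lieIdeal_finrank_ne
    {η₁ : E₁ [⋀^Fin 2]→L[ℝ] ℝ} (hη₁ : IsRiemannForm Φ₁ η₁) [LieAlgebra.IsSimple ℂ (hodgeGroupComplexLie Φ₂)]
    (h : ∀ C : LieIdeal ℂ (hodgeGroupComplexLie Φ₁), finrank ℂ C ≠ finrank ℂ (hodgeGroupComplexLie Φ₂))
    (hX₁ : ∀ k p, divisorClasses (powPeriod Φ₁ k) p = hodgeClasses (powPeriod Φ₁ k) p)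
    (hX₂ : ∀ k p, divisorClasses (powPeriod Φ₂ k) p = hodgeClasses (powPeriod Φ₂ k) p) :
    ∀ k p, divisorClasses (powPeriod (prodPeriod Φ₁ Φ₂) k) p = hodgeClasses (powPeriod (prodPeriod Φ₁ Φ₂) k) p :=
  forall_divisorClasses_powPeriod_prod_eq_hodgeClasses_of_hodgeGroupC_prod_eq
    (hη₁.hodgeGroupC_prod_eq_blockDiagProd_of_isSimple_of_forall_lieIdeal_finrank_ne Φ₁ Φ₂ h) hX₁ hX₂

/-- Analytic form of §1: `𝔥𝔤_ℂ(X₂)` simple and the product not split ⟹ `𝔥𝔤_ℂ(X₁ × X₂) ≅ 𝔥𝔤_ℂ(X₁)`.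
[cite: MoonenZarhin1999LowDim, §3 (3.1) and Lemma (3.7) (proof)] -/
theorem nonempty_lieEquiv_hodgeGroupComplexLie_of_isSimple_right_of_ne [h₂ : LieAlgebra.IsSimple ℂ (hodgeGroupComplexLie Φ₂)]
    (hne : hodgeGroupC (prodPeriod Φ₁ Φ₂) ≠ blockDiagProd (hodgeGroupC Φ₁) (hodgeGroupC Φ₂)) :
    Nonempty (hodgeGroupComplexLie (prodPeriod Φ₁ Φ₂) ≃ₗ⁅ℂ⁆ hodgeGroupComplexLie Φ₁) := by
  rw [hodgeGroupComplexLie_eq_lieSubalgebraGL Φ₂] at h₂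
  rw [hodgeGroupComplexLie_eq_lieSubalgebraGL (prodPeriod Φ₁ Φ₂), hodgeGroupComplexLie_eq_lieSubalgebraGL Φ₁]
  exact nonempty_lieEquiv_of_isSimple_right_of_ne Φ₁ Φ₂ hne

/-- Analytic form: `𝔥𝔤_ℂ(X₂)` simple and the product not split ⟹ `𝔥𝔤_ℂ(X₂)` is a quotient of `𝔥𝔤_ℂ(X₁)`.
[cite: MoonenZarhin1999LowDim, §3 (3.1) and Lemma (3.7) (proof)] -/
theorem exists_surjective_lieHom_hodgeGroupComplexLie_of_isSimple_right_of_ne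
    [h₂ : LieAlgebra.IsSimple ℂ (hodgeGroupComplexLie Φ₂)]
    (hne : hodgeGroupC (prodPeriod Φ₁ Φ₂) ≠ blockDiagProd (hodgeGroupC Φ₁) (hodgeGroupC Φ₂)) :
    ∃ q : hodgeGroupComplexLie Φ₁ →ₗ⁅ℂ⁆ hodgeGroupComplexLie Φ₂, Function.Surjective q := by
  rw [hodgeGroupComplexLie_eq_lieSubalgebraGL Φ₂] at h₂ ⊢
  rw [hodgeGroupComplexLie_eq_lieSubalgebraGL Φ₁]
  exact exists_surjective_lieHom_of_isSimple_right_of_ne Φ₁ Φ₂ hne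

end ComplexTorus

end Literature.Geometry.Kaehler

end
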